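import Mathlib.MeasureTheory.Function.SpecialFunctions.Basic
import Mathlib.MeasureTheory.Function.SpecialFunctions.Inner
import Literature.MathematicalPhysics.KineticTheory.EvenCollisionTubeFunctional
import Literature.Analysis.FluidPDE.HardSphereCollisionRecord
import HarnessLib

/-!
# The collision-cylinder pull-back along hard-sphere orbits, I: vocabulary

Topic `Literature/MathematicalPhysics/KineticTheory` (definition item; wanted by the crux line
`even-rung-mean-variance` of `JParityClosure.EvenStressEnskog`, stmt-AtomisticToContinuum-13079, and
its sibling stmt-13078).  Boltzmann's collision-cylinder argument (CIP 1994 §2.2) read on ONE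
hard-sphere orbit on `𝕋³` (GST 2013 §4.1): the collision sum `K_N[χ g Ψ] = collisionSum …`
(`EvenCollisionTubeFunctional`) is compared with the time integral of the fixed-time tube functional
`tubeStat … 1 κ t` (`CollisionTubeFunctional`) by pulling every collision back along the free flight of
its pair.  This file fixes the explicit functionals of a configuration / of an orbit that the pull-back
produces; the estimates are proved in the sequel files `CollisionTubePullback{Geometry, Flight,
Stretch, Pair, Assembly, Packing, Pathwise}`.

* `hitTime ε q w`, `sepAt ζ i j`, `relVel ζ i j`, `weightAt … t ζ i`, `tubeTerm … t ζ i j` — the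
  summands of `tubeStat` at truncation level `1` (`tubeStat_one_eq`: the reweighting
  `min(1 + e^{−F̃}, 1) = 1` is inert); `collMark … ζ i j` — the collision mark `Ψ(ε⁻¹q, vᵢ⁻, vⱼ⁻)`
  (pre-collisional velocities by the involution `reflectVel`); `orbit σ N Φ z s = Φ.flow s z` and the
  identification `collisionSum = ε/(N+1) · collisionPairSum …` (`collisionSum_eq_collisionPairSum`).
* `pairFlightStart … i j s` — the last participation time of `i` or `j` in `(0, s)` (else `0`).
* the REMAINDER functionals of the pull-back: `shellInd`, `shellCount`, `pairShellCount` (static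
  near-contact shell `ε < ‖q‖ ≤ ε(1 + 2Lκ)` counts), `threeBodyCollisionSum` (collision sum of the
  three-body mark `shellCount`), `collisionMismatch`, `continuityCorrection`, `shortFlightDeficit`.
* two facts on the minimal image (`reprSym_proj_eq_of_norm_lt`, `reprSym_add_proj_of_norm_lt`) and
  measurable building blocks (`measurable_torusReprSym_comp`, `measurable_torusDist_comp`,
  `measurableSet_tubePredicate`).

## References

* C. Cercignani, R. Illner, M. Pulvirenti, *The Mathematical Theory of Dilute Gases* (1994), §2.2
  (Boltzmann's collision cylinder: the molecules about to hit a given one within time `dt` fill the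
  cylinder of height `|V · n| dt` over the protection sphere; pre-collisional hemisphere `V · n < 0`).
  [CIPDiluteGases1994]
* I. Gallagher, L. Saint-Raymond, B. Texier, *From Newton to Boltzmann* (2013), Part II Ch. 4, §4.1
  (the hard-sphere flow: free flow between collisions, elastic reflection at `|xᵢ − xⱼ| = ε`,
  pre-collisional iff `νⁱʲ · (vᵢ − vⱼ) < 0`; Prop. 4.1.1, Def. 4.1.2). [GallagherSaintRaymondTexier2013]
-/

noncomputable section

open scoped BigOperators Classical InnerProductSpace ENNReal Topology
open Set MeasureTheory Filter Function
open Literature.Analysis.FluidPDE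

namespace Literature.MathematicalPhysics.KineticTheory

/-! ## The minimal image along short free flights on `𝕋³` -/

section Covering

/-- A vector of `ℝ³` of norm `< 1/2` is its own minimal image: `reprSym (proj a) = a`. [folklore] -/
theorem reprSym_proj_eq_of_norm_lt {a : V3} (ha : ‖a‖ < 1 / 2) :
    Torus.reprSym (Literature.Analysis.FunctionSpaces.Torus.proj a) = a := by
  have h := @Torus.reprSym_add_proj (Fin 3) (0 : UnitAddTorus (Fin 3)) a (fun i => ?_)
  · simpa using h
  · have hi : |a i| < 1 / 2 := lt_of_le_of_lt (by simpa using PiLp.norm_apply_le a i) ha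
    rw [Torus.reprSym_zero]
    simp only [PiLp.zero_apply, zero_add, mem_Ioc]
    rw [abs_lt] at hi
    exact ⟨hi.1, hi.2.le⟩

/-- The minimal image is additive along the covering map for small vectors: if
`‖reprSym X + c‖ < 1/2` then `reprSym (X + proj c) = reprSym X + c`. [folklore] -/
theorem reprSym_add_proj_of_norm_lt {X : UnitAddTorus (Fin 3)} {c : V3}
    (h : ‖Torus.reprSym X + c‖ < 1 / 2) :
    Torus.reprSym (X + Literature.Analysis.FunctionSpaces.Torus.proj c) = Torus.reprSym X + c := by
  refine Torus.reprSym_add_proj fun i => ?_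
  have hi : |(Torus.reprSym X + c) i| < 1 / 2 :=
    lt_of_le_of_lt (by simpa using PiLp.norm_apply_le (Torus.reprSym X + c) i) h
  rw [abs_lt] at hi
  simp only [PiLp.add_apply] at hi
  exact ⟨hi.1, hi.2.le⟩

end Covering

/-! ## Measurable building blocks (compositional form, for `fun_prop`) -/

section MeasurableBlocks

variable {α : Type*} [MeasurableSpace α]

/-- The symmetric representative `reprSym : 𝕋³ → ℝ³` composed with a measurable map is
measurable. [folklore] -/
theorem measurable_torusReprSym_comp {f : α → UnitAddTorus (Fin 3)} (hf : Measurable f) :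
    Measurable fun a => Torus.reprSym (f a) :=
  Torus.measurable_reprSym.comp hf

/-- The minimal-image distance of two measurable torus-valued maps is measurable. [folklore] -/
theorem measurable_torusDist_comp {f g : α → UnitAddTorus (Fin 3)} (hf : Measurable f)
    (hg : Measurable g) : Measurable fun a => Torus.euclidDist (f a) (g a) := by
  simp only [Torus.euclidDist_eq]
  exact (Torus.measurable_reprSym.comp (hf.sub hg)).norm

/-- The tube predicate `P ∧ f₁ < g₁ ∧ f₂ < g₂ ∧ f₃ ≤ g₃ ∧ f₄ ≤ g₄` of measurable real functions cuts
out a measurable set. [folklore] -/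
theorem measurableSet_tubePredicate (P : Prop) {f₁ g₁ f₂ g₂ f₃ g₃ f₄ g₄ : α → ℝ}
    (hf₁ : Measurable f₁) (hg₁ : Measurable g₁) (hf₂ : Measurable f₂) (hg₂ : Measurable g₂)
    (hf₃ : Measurable f₃) (hg₃ : Measurable g₃) (hf₄ : Measurable f₄) (hg₄ : Measurable g₄) :
    MeasurableSet {a | P ∧ f₁ a < g₁ a ∧ f₂ a < g₂ a ∧ f₃ a ≤ g₃ a ∧ f₄ a ≤ g₄ a} :=
  (MeasurableSet.const P).inter ((measurableSet_lt hf₁ hg₁).inter ((measurableSet_lt hf₂ hg₂).inter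
    ((measurableSet_le hf₃ hg₃).inter (measurableSet_le hf₄ hg₄))))

end MeasurableBlocks

/-! ## The summands of the tube functional at truncation level `1` -/

section TubeTerm

variable (σ : ℝ) (N : ℕ) (χ : ℝ × UnitAddTorus (Fin 3) → ℝ) (g : ℝ → ℝ) (Ψ : V3 × V3 × V3 → ℝ)
  (r κ : ℝ)

/-- The predicted hitting time `t_h(q, w) = (−b − √(b² − ac))/a` of a pair at separation `q` with
relative velocity `w` (`a = ‖w‖²`, `b = ⟪q, w⟫`, `c = ‖q‖² − ε²`), as in `tubeStat`. [folklore] -/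
def hitTime (ε : ℝ) (q w : V3) : ℝ :=
  (-⟪q, w⟫_ℝ - Real.sqrt (⟪q, w⟫_ℝ ^ 2 - ‖w‖ ^ 2 * (‖q‖ ^ 2 - ε ^ 2))) / ‖w‖ ^ 2

/-- The minimal-image separation vector `q = sepVec xᵢ xⱼ` of the ordered pair `(i, j)`. [folklore] -/
def sepAt {N : ℕ} (ζ : Config (N + 1) (Fin 3) T3) (i j : Fin (N + 1)) : V3 :=
  (Torus.geometry (Fin 3)).sepVec (ζ i).1 (ζ j).1

/-- The relative velocity `w = vᵢ − vⱼ` of the ordered pair `(i, j)`. [folklore] -/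
def relVel {N : ℕ} (ζ : Config (N + 1) (Fin 3) T3) (i j : Fin (N + 1)) : V3 :=
  (ζ i).2 - (ζ j).2

/-- The weight `χ(t, xᵢ) g(σ³ ρ_r(xᵢ))` read on particle `i` of a configuration. [folklore] -/
def weightAt (t : ℝ) (ζ : Config (N + 1) (Fin 3) T3) (i : Fin (N + 1)) : ℝ :=
  χ (t, (ζ i).1) * g (σ ^ 3 * mollDensity r ζ (ζ i).1)

/-- The `(i, j)` summand of the tube functional at truncation level `1` (where the reweighting
`min(1 + e^{−F̃}, 1) = 1` is inert): the tube indicator (apart, approaching, reaching contact,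
within the flight-time window `κ ε`) times `χ g Ψ(n_h, vᵢ, vⱼ)` with the predicted contact normal
`n_h = ε⁻¹ (q + t_h w)`. [folklore] -/
def tubeTerm (t : ℝ) (ζ : Config (N + 1) (Fin 3) T3) (i j : Fin (N + 1)) : ℝ :=
  if i ≠ j ∧ hsDiameter σ N < ‖sepAt ζ i j‖ ∧ ⟪sepAt ζ i j, relVel ζ i j⟫_ℝ < 0 ∧
      ‖relVel ζ i j‖ ^ 2 * (‖sepAt ζ i j‖ ^ 2 - hsDiameter σ N ^ 2) ≤ ⟪sepAt ζ i j, relVel ζ i j⟫_ℝ ^ 2 ∧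
      hitTime (hsDiameter σ N) (sepAt ζ i j) (relVel ζ i j) ≤ κ * hsDiameter σ N then
    weightAt σ N χ g r t ζ i *
      Ψ ((hsDiameter σ N)⁻¹ • (sepAt ζ i j + hitTime (hsDiameter σ N) (sepAt ζ i j) (relVel ζ i j) •
          relVel ζ i j), (ζ i).2, (ζ j).2)
  else 0

/-- **The tube functional at level `1` is the weighted double sum of the tube terms**:
`tubeStat σ N χ g Ψ r ϑ 1 κ t ζ = ((N+1)κ)⁻¹ Σᵢ Σⱼ tubeTerm … t ζ i j` (the reweighting
`min (1 + e^{−F̃}) 1 = 1` is inert, so the velocity-mollification scale `ϑ` is a dummy). [folklore] -/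
theorem tubeStat_one_eq (ϑ t : ℝ) (ζ : Config (N + 1) (Fin 3) T3) :
    tubeStat σ N χ g Ψ r ϑ 1 κ t ζ =
      ((N + 1 : ℝ) * κ)⁻¹ * ∑ i : Fin (N + 1), ∑ j : Fin (N + 1), tubeTerm σ N χ g Ψ r κ t ζ i j := by
  have hmin : ∀ x : ℝ, min (1 + Real.exp x) 1 = 1 := fun x =>
    min_eq_right (le_add_of_nonneg_right (Real.exp_pos x).le)
  dsimp only [tubeStat, tubeTerm, sepAt, relVel, weightAt, hitTime, mollDensity, coneKernel]
  simp only [hmin, mul_one]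
  congr 1

end TubeTerm

/-! ## The collision side: the collision sum as a `collisionPairSum` -/

section CollisionSide

variable (σ : ℝ) (N : ℕ) (χ : ℝ × UnitAddTorus (Fin 3) → ℝ) (g : ℝ → ℝ) (Ψ : V3 × V3 × V3 → ℝ)
  (r : ℝ)

/-- The collision mark `Ψ(ε⁻¹ q, vᵢ⁻, vⱼ⁻)` of the ordered pair `(i, j)` read off a (post-collisional)
configuration, the pre-collisional velocities being recovered by the involution `reflectVel q`.
[folklore] -/
def collMark (ζ : Config (N + 1) (Fin 3) T3) (i j : Fin (N + 1)) : ℝ :=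
  Ψ ((hsDiameter σ N)⁻¹ • sepAt ζ i j, (reflectVel (sepAt ζ i j) ((ζ i).2, (ζ j).2)).1,
    (reflectVel (sepAt ζ i j) ((ζ i).2, (ζ j).2)).2)

/-- The orbit `s ↦ Φ_s z` of an initial datum under a hard-sphere flow. [folklore] -/
def orbit (Φ : HardSphereFlow (Torus.geometry (Fin 3)) (hsDiameter σ N) (N + 1))
    (z : Config (N + 1) (Fin 3) T3) : ℝ → Config (N + 1) (Fin 3) T3 :=
  fun s => Φ.flow s z

/-- Unfolding of the orbit. [folklore] -/
@[simp]
theorem orbit_apply (Φ : HardSphereFlow (Torus.geometry (Fin 3)) (hsDiameter σ N) (N + 1))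
    (z : Config (N + 1) (Fin 3) T3) (s : ℝ) : orbit σ N Φ z s = Φ.flow s z := rfl

/-- **The collision sum is `ε/(N+1)` times a collision pair sum** of the weight-times-mark over the
window `[0, τ]`, along any orbit that stays in the hard-sphere domain (e.g. a good orbit).
[folklore] -/
theorem collisionSum_eq_collisionPairSum
    (Φ : HardSphereFlow (Torus.geometry (Fin 3)) (hsDiameter σ N) (N + 1)) (τ : ℝ)
    (z : Config (N + 1) (Fin 3) T3)
    (hdom : ∀ s, orbit σ N Φ z s ∈ hardSphereDomain (Torus.geometry (Fin 3)) (N + 1) (hsDiameter σ N)) :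
    Literature.MathematicalPhysics.KineticTheory.collisionSum σ N Φ τ χ g Ψ r z =
      hsDiameter σ N / (N + 1 : ℝ) *
        collisionPairSum (Torus.geometry (Fin 3)) (hsDiameter σ N) (orbit σ N Φ z) (Icc 0 τ)
          (fun s i j => weightAt σ N χ g r s (orbit σ N Φ z s) i * collMark σ N Ψ (orbit σ N Φ z s) i j) := by
  rw [collisionPairSum_eq_finsum_ite hdom]
  rfl

end CollisionSide

/-! ## The pair flight start -/

section PairPieces

variable (σ : ℝ) (N : ℕ) (Φ : HardSphereFlow (Torus.geometry (Fin 3)) (hsDiameter σ N) (N + 1))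
  (z : Config (N + 1) (Fin 3) T3)

/-- The **pair flight start** of `(i, j)` at time `s`: the last time in `(0, s)` at which `i` or `j`
took part in a collision, or `0` if there is none (`= max` of the two `flightStart`s of
`HardSphereCollisionRecord`): the flights of `i` and `j` are both free on `(pairFlightStart, s)`.
[folklore] -/
def pairFlightStart (i j : Fin (N + 1)) (s : ℝ) : ℝ :=
  max (flightStart (Torus.geometry (Fin 3)) (hsDiameter σ N) (orbit σ N Φ z) 0 i s)
    (flightStart (Torus.geometry (Fin 3)) (hsDiameter σ N) (orbit σ N Φ z) 0 j s)

end PairPieces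

/-! ## Explicit remainder functionals -/

section Remainders

variable (σ : ℝ) (N : ℕ)

/-- Indicator of the **near-contact shell** `ε < ‖q‖ ≤ ε (1 + 2 L κ)` for the ordered pair `(i, j)`
of a configuration (a static two-body functional). [folklore] -/
def shellInd (L κ : ℝ) (ζ : Config (N + 1) (Fin 3) T3) (i j : Fin (N + 1)) : ℝ :=
  if hsDiameter σ N < ‖sepAt ζ i j‖ ∧ ‖sepAt ζ i j‖ ≤ hsDiameter σ N * (1 + 2 * L * κ) then 1 else 0

/-- The **number of particles in the near-contact shell of particle `p`** (a static functional).
[folklore] -/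
def shellCount (L κ : ℝ) (ζ : Config (N + 1) (Fin 3) T3) (p : Fin (N + 1)) : ℝ :=
  ∑ l : Fin (N + 1), shellInd σ N L κ ζ p l

/-- The **number of ordered pairs in the near-contact shell** (a static two-body count). [folklore] -/
def pairShellCount (L κ : ℝ) (ζ : Config (N + 1) (Fin 3) T3) : ℝ :=
  ∑ i : Fin (N + 1), ∑ j : Fin (N + 1), shellInd σ N L κ ζ i j

/-- The **three-body collision sum** `N₃(z)`: over the collisions `(s, p, q)` of the orbit of `z`
with `s ∈ (0, τ]`, the number of third particles in the near-contact shell of the colliding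
particle `p` at the collision time (a collision sum with a static three-body mark). [folklore] -/
def threeBodyCollisionSum (Φ : HardSphereFlow (Torus.geometry (Fin 3)) (hsDiameter σ N) (N + 1))
    (τ L κ : ℝ) (z : Config (N + 1) (Fin 3) T3) : ℝ :=
  collisionPairSum (Torus.geometry (Fin 3)) (hsDiameter σ N) (orbit σ N Φ z) (Ioc 0 τ)
    fun s p _ => shellCount σ N L κ (orbit σ N Φ z s) p

/-- The **collision-side mismatch** `R₁(z)`: over the collisions `(s, i, j)` of the orbit with
`s ∈ [0, τ]`, `|Ψ_c| · |κ ε · (χ g)(s) − ∫_{W} (χ g)(t) dt|`, where the window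
`W = (pairFlightStart, s) ∩ [s − κ ε, ∞)` is the part of the nominal tube window `[s − κε, s)`
during which both partners actually flew freely (it is short when a third body hit one of them
within `κ ε` before the collision, or when `s < κ ε`), and the integrand is the weight read along
the orbit (continuity correction). [folklore] -/
def collisionMismatch (Φ : HardSphereFlow (Torus.geometry (Fin 3)) (hsDiameter σ N) (N + 1))
    (τ : ℝ) (χ : ℝ × UnitAddTorus (Fin 3) → ℝ) (g : ℝ → ℝ) (Ψ : V3 × V3 × V3 → ℝ) (r κ : ℝ)
    (z : Config (N + 1) (Fin 3) T3) : ℝ :=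
  collisionPairSum (Torus.geometry (Fin 3)) (hsDiameter σ N) (orbit σ N Φ z) (Icc 0 τ)
    fun s i j => |collMark σ N Ψ (orbit σ N Φ z s) i j| *
      |κ * hsDiameter σ N * weightAt σ N χ g r s (orbit σ N Φ z s) i -
        ∫ t in Ioo (pairFlightStart σ N Φ z i j s) s ∩ Ici (s - κ * hsDiameter σ N),
          weightAt σ N χ g r t (orbit σ N Φ z t) i|

variable {σ N}

/-- The shell indicator is `0` or `1`, in particular nonnegative and at most `1`. [folklore] -/
theorem shellInd_nonneg (L κ : ℝ) (ζ : Config (N + 1) (Fin 3) T3) (i j : Fin (N + 1)) :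
    0 ≤ shellInd σ N L κ ζ i j := by
  unfold shellInd; split_ifs <;> norm_num

/-- The shell indicator is symmetric in the pair (the minimal-image distance is symmetric).
[folklore] -/
theorem shellInd_comm (L κ : ℝ) (ζ : Config (N + 1) (Fin 3) T3) (i j : Fin (N + 1)) :
    shellInd σ N L κ ζ i j = shellInd σ N L κ ζ j i := by
  have h : ‖sepAt ζ i j‖ = ‖sepAt ζ j i‖ := by
    unfold sepAt
    rw [Torus.norm_geometry_sepVec, Torus.norm_geometry_sepVec, Torus.euclidDist_comm]
  unfold shellInd
  rw [h]

end Remainders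

/-! ## The continuity correction and the short-flight deficit -/

section MismatchDefs

variable (σ : ℝ) (N : ℕ)

/-- The **continuity correction** `R_cont(z)`: over the collisions `(s, i, j)` with `s ∈ [0, τ]`,
`|Ψ_c| · ∫_{max(0, s − κε)}^{s} |(χ g)(t, x_i(t)) − (χ g)(s, x_i(s))| dt` — the oscillation of the
weight over the nominal tube window, read along the orbit (a finite sum over collision times of time
integrals of a function of `Φ_t z`). [folklore] -/
def continuityCorrection (Φ : HardSphereFlow (Torus.geometry (Fin 3)) (hsDiameter σ N) (N + 1))
    (τ : ℝ) (χ : ℝ × UnitAddTorus (Fin 3) → ℝ) (g : ℝ → ℝ) (Ψ : V3 × V3 × V3 → ℝ) (r κ : ℝ)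
    (z : Config (N + 1) (Fin 3) T3) : ℝ :=
  collisionPairSum (Torus.geometry (Fin 3)) (hsDiameter σ N) (orbit σ N Φ z) (Icc 0 τ)
    fun s i j => |collMark σ N Ψ (orbit σ N Φ z s) i j| *
      ∫ t in Icc (max 0 (s - κ * hsDiameter σ N)) s,
        |weightAt σ N χ g r t (orbit σ N Φ z t) i - weightAt σ N χ g r s (orbit σ N Φ z s) i|

/-- The **short-flight deficit** `R_short(z)`: over the collisions `(s, i, j)` with `s ∈ [0, τ]`,
`|Ψ_c| · (pairFlightStart − (s − κε))₊` — the length by which the actual free window of the pair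
before the collision falls short of the nominal `κ ε`; it is nonzero exactly when a third body hit
`i` or `j` during `(s − κε, s)` (short flight) or `s < κ ε` (early time boundary). [folklore] -/
def shortFlightDeficit (Φ : HardSphereFlow (Torus.geometry (Fin 3)) (hsDiameter σ N) (N + 1))
    (τ : ℝ) (Ψ : V3 × V3 × V3 → ℝ) (κ : ℝ) (z : Config (N + 1) (Fin 3) T3) : ℝ :=
  collisionPairSum (Torus.geometry (Fin 3)) (hsDiameter σ N) (orbit σ N Φ z) (Icc 0 τ)
    fun s i j => |collMark σ N Ψ (orbit σ N Φ z s) i j| *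
      max (pairFlightStart σ N Φ z i j s - (s - κ * hsDiameter σ N)) 0

end MismatchDefs

end Literature.MathematicalPhysics.KineticTheory

end
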